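import Summits.BirchSwinnertonDyer.Rank1Residual.Additive.GordRankZeroKatoComponent
import Summits.BirchSwinnertonDyer.Rank1Residual.Additive.X4SharpThreeAssembly
import HarnessLib

/-!
# X4♯(G-ord) ∩ `I₀*`, analytic rank `0`, at `p = 3` WITHOUT (ram): the Tamagawa-free,
# Manin-free upper half from a TOWER CERTIFICATE of `E` transported to the good ordinary twist
# (cell `b2b-bsdres`, seat additive-p4, line V24; sibling of additive-p2's `GordRankZeroKatoComponent.lean`)

HONEST FRAMING (cell `b2b-bsdres`, run/shared/lean/b2b/bsd-rank1-residual/, verbatim in every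
file): the goal of the cell is to DELETE the COMBINATION-SHAPED residual classes of the
Birch–Swinnerton-Dyer formula for ALL analytic-rank `≤ 1` elliptic curves over `ℚ` — "full BSD
formula for every rank `≤ 1` curve in class `C`" assembled STRICTLY from published theorems — so
that the rank-`≤ 1` remainder becomes exactly the CONSTRUCTION-SHAPED classes, which are TYPED
(missing-input `Prop`s), NOT attempted. This is not "finishing BSD". Sub-cell additive-p4 (X3♯/X4♯
direct): research route on the CONSTRUCTION-SHAPED class X4; no claim beyond the stated classes;
the label X4 is UNCHANGED by this file; nothing is booked. Theorems only (no definition, no named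
fact minted; every published input is an explicit named-fact hypothesis of the tree).

## What this file proves

Seat additive-p2's `ClassX4Gord.missingUpperBoundAt_rankZero_of_katoComponent` gives the UPPER
half `ord_p #Ш(E) ≤ ord_p #Ш_an(E)` on X4 ∧ (G-ord) ∧ `e = 2` ∧ `r_an = 0` ∧ surj(p) at every odd
`p` with NO Tamagawa and NO Manin hypothesis (Kato's divisibility on the `ω^{(p−1)/2}`-component
over `ℚ(μ_{p^∞})` for the good ordinary twist `E♭ = E^{(p*)}`, `hK`; Delbourgo 1998 Prop. 4
`hDel`; modular parametrisation data `hmodD`; GZK; modularity) — but at `p = 3` it asks `ram(3)`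
(a multiplicative prime `ℓ` with `3 ∤ ord_ℓ Δ`), used only to feed the `3`-adic tower of `E♭`
(`forall_surj_pow_of_twist_pStar_of_surj_of_ram`). The tower of `E♭` is the tower of `E`
(`GaloisImage.hasSurjectiveModNGaloisRep_pow_iff_of_model_twist`, line V21: a quadratic twist
changes `ρ̄_{E,p^n}` by a sign), so ANY tower certificate of `E` — a `j`-witness at an additive
potentially multiplicative prime, (ram), or surj(9) (`towerSurj_three_of_surj_of_jWitness_or_nine`) —
does the same job:

* `ClassX4Gord.missingUpperBoundAt_rankZero_of_katoComponent_of_towerSurj` — X4 ∧ (G-ord) ∧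
  `e = 2` ∧ `r_an = 0` ∧ `ρ̄_{E,p^n}` onto ∀ `n` ⟹ `MissingUpperBoundAt W p`, every odd `p`
  (at `p ≡ 1 (mod 4)` and at `p ≡ 3 (mod 4)`, `p ≠ 3`, only surj(p) is used; at `p = 3` the tower);
* `ClassX4Gord.missingUpperBoundAt_three_of_katoComponent_of_cert`, `…bsdp_three_of_katoComponent_of_cert_of_shaAn_unit`,
  `…missingInputAt_iff_lower_three_of_katoComponent_of_cert` — the `p = 3` census shapes with the
  certificate [`j`-witness ∨ surj(9)] in place of (ram): `BSD(E,3)` on the `3 ∤ #Ш_an` rows with NO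
  condition on `∏ c_ℓ` and NO Manin datum — so on X4 ∧ (G-ord, `e = 2`) the TAM-DEFECT and MANIN
  residue pieces of `X4SharpUnitFreeResidue` are EMPTY once a tower certificate is held.

Census (seat, window N < 2·10⁴): the (G-ord, `e = 2`) rows of X4 ∧ `p = 3` ∧ `r_an = 0` without a
(ram) prime but with a `j`-witness / mod-`9` certificate: 137 surjective rows (108 already closed by
the Kato-sharp route with its Tamagawa/Manin bits, 18 by parity, 5 lower-half rows, 3 TAM-DEFECT₂
rows 11628f1 / 16650bo1-type — numbers of record in HOME/b2b-bsdres-additive-p4/V24-*.txt); the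
3 TAM-DEFECT₂ (G-ord, `e = 2`) window rows close here. X4 stays CONSTRUCTION-SHAPED; nothing booked.

References: Kato 2004 [Kato2004Asterisque] Thm. 17.4 (3); Delbourgo 1998 [Delbourgo1998] Prop. 4;
Mazur–Tate–Teitelbaum 1986 [MazurTateTeitelbaum1986Invent] §I.13–14; Serre 1972 [Serre1972] IV §3.4;
Silverman *AEC* X.5.4; Miller 2011 [Miller2011LMS] Def. 1.1.
-/

noncomputable section

open scoped Classical MatrixGroups ModularForm

open CongruenceSubgroup WeierstrassCurve Literature.NumberTheory.EllipticCurves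
  Literature.NumberTheory.EllipticCurves.ModularForms
  Literature.NumberTheory.EllipticCurves.Rank1Residual
  Literature.NumberTheory.EllipticCurves.Rank1Residual.Typed
  IsDedekindDomain Rat.HeightOneSpectrum

namespace Summit.BirchSwinnertonDyer.Rank1Residual.Additive

variable {W : WeierstrassCurve ℚ} [W.IsElliptic] [W.IsGloballyMinimal] {p : ℕ} [hp : Fact p.Prime]

/-- **X4♯(G-ord) ∩ `I₀*`, `r_an = 0`, TOWER surjectivity of `E` (no (ram) hypothesis): the upper half
`ord_p #Ш(E) ≤ ord_p #Ш_an(E)` from named facts alone, every odd `p`.** At `p ≡ 1 (mod 4)`: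
`X4RankZeroTwistEven.missingUpperBoundAt_of_surj`; at `p ≡ 3 (mod 4)`: the tower of `E` is
transported to the good ordinary twist `E♭ = E^{(−p)}`
(`GaloisImage.hasSurjectiveModNGaloisRep_pow_iff_of_model_twist`) and fed to
`X4RankZeroTwistOdd.padicValNat_shaOrder_le_shaAn`. Inputs: Kato's component divisibility `hK`,
Delbourgo Prop. 4 `hDel`, GZK, modularity `hmod`/`hmodD`. NO Tamagawa, NO Manin, NO (ram).
[cite: Kato2004Asterisque, Thm. 17.4 (3) (p. 273)] [cite: Delbourgo1998, Prop. 4 (p. 144)]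
[cite: Miller2011LMS, Def. 1.1] -/
theorem ClassX4Gord.missingUpperBoundAt_rankZero_of_katoComponent_of_towerSurj
    (hK : Kato2004.charIdeal_dvd_padicLFunctionBranch_component_of_surjective)
    (hDel : Delbourgo1998.prop4_rankZero_pow_dvd_constantCoeff)
    (hGZK : rank_eq_analyticRank_of_analyticRank_le_one) (hmod : hasEntireLFunction_rat)
    (hmodD : nonempty_modularParametrizationData)
    (hX : ClassX4Gord W p) (he : semistabilityIndex W p = 2) (hr : W.analyticRank = 0)
    (htower : ∀ n : ℕ, W.HasSurjectiveModNGaloisRep (p ^ n : ℕ)) :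
    MissingUpperBoundAt W p := by
  have hsurj : Surj W p := by simpa using htower 1
  by_cases hp3 : p = 3
  · obtain ⟨V, iV, iVm, C, hV, hC⟩ := hX.exists_goodOrd_pStar_twist_model W p he
    haveI : NeZero (V.conductorNorm ℤ) := ⟨(V.conductorNorm_pos_holds).ne'⟩
    obtain ⟨Dm⟩ := hmodD V
    obtain ⟨ϖ', -, hϖ'⟩ := exists_rat_mul_imaginaryPeriodRat_eq_minusPeriod Dm
    have hp4 : p % 4 = 3 := by rw [hp3]
    have hC' : C • V.quadraticTwist (-(p : ℚ)) = W := by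
      rw [pStar_eq_of_mod_four p (Or.inr hp4), if_neg (by omega)] at hC
      exact hC
    have hpne : (-(p : ℚ)) ≠ 0 := neg_ne_zero.mpr (Nat.cast_ne_zero.mpr hp.out.ne_zero)
    have htowerV : ∀ n : ℕ, V.HasSurjectiveModNGaloisRep (p ^ n : ℕ) := fun n ↦
      (GaloisImage.hasSurjectiveModNGaloisRep_pow_iff_of_model_twist V p hpne ⟨C, hC'⟩ n).mp
        (htower n)
    obtain ⟨q, hq, hle⟩ := X4RankZeroTwistOdd.padicValNat_shaOrder_le_shaAn W p hDel hGZK hmod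
      (chiBranchLeadingTermOddBigImageAt_of_katoComponent W p hK
        (padicValRat_j_nonneg_of_typeGOrd W p hX.typeGOrd))
      hp4 hr hX.classX4 V C hC' (Or.inl hV) htowerV Dm.isNewformOf ϖ' hϖ'
    exact ⟨q, hq, hle⟩
  · exact ClassX4Gord.missingUpperBoundAt_rankZero_of_katoComponent hK hDel hGZK hmod hmodD hX he hr
      hsurj fun h ↦ absurd h hp3

/-- **`BSD(E,p)` on X4♯(G-ord) ∩ `I₀*` ∧ `r_an = 0` ∧ tower ∧ `p ∤ #Ш_an(E)`**, every odd `p`, with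
NO Tamagawa, NO Manin, NO (ram) hypothesis. [cite: Kato2004Asterisque, Thm. 17.4 (3) (p. 273)]
[cite: Delbourgo1998, Prop. 4 (p. 144)] [cite: Miller2011LMS, §1 and Def. 1.1] -/
theorem ClassX4Gord.bsdp_rankZero_of_katoComponent_of_towerSurj_of_shaAn_unit
    (hK : Kato2004.charIdeal_dvd_padicLFunctionBranch_component_of_surjective)
    (hDel : Delbourgo1998.prop4_rankZero_pow_dvd_constantCoeff)
    (hGZK : rank_eq_analyticRank_of_analyticRank_le_one) (hmod : hasEntireLFunction_rat)
    (hmodD : nonempty_modularParametrizationData)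
    (hX : ClassX4Gord W p) (he : semistabilityIndex W p = 2) (hr : W.analyticRank = 0)
    (htower : ∀ n : ℕ, W.HasSurjectiveModNGaloisRep (p ^ n : ℕ))
    {q : ℚ} (hq : shaAn W = (q : ℂ)) (hv : padicValRat p q = 0) : BSDp W p :=
  bsdp_of_missingPPartAt W p hGZK (by rw [hr]; exact zero_le_one)
    (missingPPartAt_of_upper_of_shaAn_unit W p
      (ClassX4Gord.missingUpperBoundAt_rankZero_of_katoComponent_of_towerSurj hK hDel hGZK hmod hmodD
        hX he hr htower) hq hv)

/-- **X4♯(G-ord) ∩ `I₀*` ∧ `r_an = 0` ∧ tower: what remains of X4♯ is EXACTLY the lower half**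
(`Typed.X4.MissingInputAt W p ↔ MissingLowerBoundAt W p`), every odd `p`.
[cite: Kato2004Asterisque, Thm. 17.4 (3) (p. 273)] [cite: Delbourgo1998, Prop. 4 (p. 144)] -/
theorem ClassX4Gord.missingInputAt_iff_lower_rankZero_of_katoComponent_of_towerSurj
    (hK : Kato2004.charIdeal_dvd_padicLFunctionBranch_component_of_surjective)
    (hDel : Delbourgo1998.prop4_rankZero_pow_dvd_constantCoeff)
    (hGZK : rank_eq_analyticRank_of_analyticRank_le_one) (hmod : hasEntireLFunction_rat)
    (hmodD : nonempty_modularParametrizationData)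
    (hX : ClassX4Gord W p) (he : semistabilityIndex W p = 2) (hr : W.analyticRank = 0)
    (htower : ∀ n : ℕ, W.HasSurjectiveModNGaloisRep (p ^ n : ℕ)) :
    X4.MissingInputAt W p ↔ MissingLowerBoundAt W p :=
  ⟨fun h ↦ (lower_and_upper_of_missingPPartAt W p h).1, fun h ↦
    missingPPartAt_of_lower_of_upper W p h
      (ClassX4Gord.missingUpperBoundAt_rankZero_of_katoComponent_of_towerSurj hK hDel hGZK hmod hmodD
        hX he hr htower)⟩

/-! ### `p = 3` census shapes: the certificate [`j`-witness ∨ surj(9)] in place of (ram) -/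

/-- **`p = 3`, X4♯(G-ord) ∩ `I₀*`, `r_an = 0`, surj(3) + [`j`-WITNESS ∨ surj(9)]: the upper half**
— the tower by `towerSurj_three_of_surj_of_jWitness_or_nine`; NO (ram), NO Tamagawa, NO Manin.
[cite: Kato2004Asterisque, Thm. 17.4 (3) (p. 273)] [cite: Delbourgo1998, Prop. 4 (p. 144)]
[cite: Serre1972, §1.11–1.12 (pp. 273–275)] [cite: Miller2011LMS, Def. 1.1] -/
theorem ClassX4Gord.missingUpperBoundAt_three_of_katoComponent_of_cert
    {W : WeierstrassCurve ℚ} [W.IsElliptic] [W.IsGloballyMinimal]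
    (hK : Kato2004.charIdeal_dvd_padicLFunctionBranch_component_of_surjective)
    (hDel : Delbourgo1998.prop4_rankZero_pow_dvd_constantCoeff)
    (hGZK : rank_eq_analyticRank_of_analyticRank_le_one) (hmod : hasEntireLFunction_rat)
    (hmodD : nonempty_modularParametrizationData)
    (hX : ClassX4Gord W 3) (he : semistabilityIndex W 3 = 2) (hr : W.analyticRank = 0)
    (hsurj : Surj W 3)
    (hcert : (∃ q : ℕ, q.Prime ∧ q ≠ 3 ∧ padicValRat q W.j < 0 ∧ ¬ (3 : ℤ) ∣ padicValRat q W.j) ∨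
      W.HasSurjectiveModNGaloisRep 9) :
    MissingUpperBoundAt W 3 :=
  ClassX4Gord.missingUpperBoundAt_rankZero_of_katoComponent_of_towerSurj hK hDel hGZK hmod hmodD hX he
    hr (towerSurj_three_of_surj_of_jWitness_or_nine W hsurj hcert)

/-- **`p = 3`, X4♯(G-ord) ∩ `I₀*`, `r_an = 0`, surj(3) + [`j`-witness ∨ surj(9)], `3 ∤ #Ш_an`:
`BSD(E,3)`** — whatever `∏ c_ℓ`, no Manin datum. [cite: Kato2004Asterisque, Thm. 17.4 (3) (p. 273)]
[cite: Delbourgo1998, Prop. 4 (p. 144)] [cite: Miller2011LMS, §1 and Def. 1.1] -/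
theorem ClassX4Gord.bsdp_three_of_katoComponent_of_cert_of_shaAn_unit
    {W : WeierstrassCurve ℚ} [W.IsElliptic] [W.IsGloballyMinimal]
    (hK : Kato2004.charIdeal_dvd_padicLFunctionBranch_component_of_surjective)
    (hDel : Delbourgo1998.prop4_rankZero_pow_dvd_constantCoeff)
    (hGZK : rank_eq_analyticRank_of_analyticRank_le_one) (hmod : hasEntireLFunction_rat)
    (hmodD : nonempty_modularParametrizationData)
    (hX : ClassX4Gord W 3) (he : semistabilityIndex W 3 = 2) (hr : W.analyticRank = 0)
    (hsurj : Surj W 3)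
    (hcert : (∃ q : ℕ, q.Prime ∧ q ≠ 3 ∧ padicValRat q W.j < 0 ∧ ¬ (3 : ℤ) ∣ padicValRat q W.j) ∨
      W.HasSurjectiveModNGaloisRep 9)
    {q : ℚ} (hq : shaAn W = (q : ℂ)) (hv : padicValRat 3 q = 0) : BSDp W 3 :=
  ClassX4Gord.bsdp_rankZero_of_katoComponent_of_towerSurj_of_shaAn_unit hK hDel hGZK hmod hmodD hX
    he hr (towerSurj_three_of_surj_of_jWitness_or_nine W hsurj hcert) hq hv

/-- **`p = 3`, X4♯(G-ord) ∩ `I₀*`, `r_an = 0`, surj(3) + [`j`-witness ∨ surj(9)]: what remains is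
EXACTLY the lower half.** [cite: Kato2004Asterisque, Thm. 17.4 (3) (p. 273)] [cite: Delbourgo1998, Prop. 4 (p. 144)] -/
theorem ClassX4Gord.missingInputAt_iff_lower_three_of_katoComponent_of_cert
    {W : WeierstrassCurve ℚ} [W.IsElliptic] [W.IsGloballyMinimal]
    (hK : Kato2004.charIdeal_dvd_padicLFunctionBranch_component_of_surjective)
    (hDel : Delbourgo1998.prop4_rankZero_pow_dvd_constantCoeff)
    (hGZK : rank_eq_analyticRank_of_analyticRank_le_one) (hmod : hasEntireLFunction_rat)
    (hmodD : nonempty_modularParametrizationData)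
    (hX : ClassX4Gord W 3) (he : semistabilityIndex W 3 = 2) (hr : W.analyticRank = 0)
    (hsurj : Surj W 3)
    (hcert : (∃ q : ℕ, q.Prime ∧ q ≠ 3 ∧ padicValRat q W.j < 0 ∧ ¬ (3 : ℤ) ∣ padicValRat q W.j) ∨
      W.HasSurjectiveModNGaloisRep 9) :
    X4.MissingInputAt W 3 ↔ MissingLowerBoundAt W 3 :=
  ClassX4Gord.missingInputAt_iff_lower_rankZero_of_katoComponent_of_towerSurj hK hDel hGZK hmod hmodD
    hX he hr (towerSurj_three_of_surj_of_jWitness_or_nine W hsurj hcert)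

end Summit.BirchSwinnertonDyer.Rank1Residual.Additive

end
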